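import Literature.Computability.Cryptography.LWECandE2Law
import Literature.Computability.Cryptography.LWERaisePadProg
import Literature.Computability.Cryptography.LWEHybridT2Prog
import Literature.Computability.Cryptography.LWEGuessTestBridge
import HarnessLib

/-!
# The machine's candidate-2 run: raise, pad, extend, shift, hybrid-`T₂`, then the rate-guess test — closed form and law on uniform coins

Topic `Computability/Cryptography` (LWE), grouping namespace `BLPRS2013.KProg`; composition of the program files of the h₃ machine (`LWERaisePadProg.lean`,
`LWEShiftDimProg.lean`, `LWEHybridT2Prog.lean`, `LWEGuessTestBridge.lean`) along ONE coin string cut into consecutive regions, and its law: the verdict bit of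
candidate 2 of `BLPRSSection4AssemblyApprox` (`raiseThen χ̃_u (padThen (Ẽ₂ ∘ test))`, `LWECandE2Law.machE₂`) on an input tuple, with the subroutine's decisions folded
in as a decision map `dec`. Everything PROVED; definitions with bodies; no named fact:

* `uniformVector_map_split` (a function of `(prefix, rest)` of a uniform string: `bind` of the prefix law) — the one plumbing lemma used five times;
* `c2M`, the region widths `c2W₁ … c2W₄`, the stages `c2T4 … c2T1` (test; hybrid `T₂` then test; shift then …; extension then …), `c2Bit` (raise, pad, then stage 1: the verdict bit);
* `uniformVector_map_c2T4/3/2/1`, **`uniformVector_map_c2Bit`** — over uniform coins of length `≥ W₁+W₂+W₃+W₄+W_test` the verdict bit has the law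
  `raiseThen (psiLaw …) Mx (padThen h (machE₂ … (machTest … (decKernel dec (lenOf coins₃))))) S` (`c2Law_eq`, by `rfl`).

## References

* Z. Brakerski, A. Langlois, C. Peikert, O. Regev, D. Stehlé, *Classical hardness of learning with errors*, STOC 2013; arXiv:1306.0281, Thm. 4.1 (proof), Lemma 4.9
  (proof, `ℬ₂`), Lemma 2.15 and §5. [BrakerskiEtAl2013]
* S. Arora, B. Barak, *Computational Complexity: A Modern Approach*, CUP 2009, Def. 7.1 (one uniform tape, cut into regions). [AroraBarak2009]
-/

noncomputable section

open scoped ENNReal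
open PMF Literature.Probability.Distributions Literature.Algebra.EuclideanLattices

namespace Literature.Computability.Cryptography

namespace BLPRS2013

namespace KProg

open GaussRejMachine LWE LWE.MP12 LWE.MP12.Prog

/-! ### The plumbing lemma -/

/-- **A function of `(prefix, rest)` of a uniform string**: its law is the prefix's law `bind` the rest's. [cite: AroraBarak2009, Def. 7.1] -/
theorem uniformVector_map_split {α β : Type} {k C : ℕ} (hk : k ≤ C) (f : List.Vector Bool k → α) (g : α → List.Vector Bool (C - k) → β) :
    (uniformOfFintype (List.Vector Bool C)).map (fun v => g (f (vecSplit k C hk v).1) (vecSplit k C hk v).2) =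
      ((uniformOfFintype (List.Vector Bool k)).map f).bind fun a => (uniformOfFintype (List.Vector Bool (C - k))).map (g a) := by
  classical
  rw [show (fun v : List.Vector Bool C => g (f (vecSplit k C hk v).1) (vecSplit k C hk v).2) =
      (fun pr : List.Vector Bool k × List.Vector Bool (C - k) => g (f pr.1) pr.2) ∘ vecSplit k C hk from rfl,
    ← PMF.map_comp, uniformVector_map_vecSplit, uniformOfFintype_prod_eq_bind, PMF.map_bind, PMF.bind_map]
  simp only [PMF.map_comp, Function.comp_def]

/-- `toList` of the two halves of a split. [folklore] -/
theorem vecSplit_toList {k C : ℕ} (hk : k ≤ C) (v : List.Vector Bool C) :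
    (vecSplit k C hk v).1.toList = v.toList.take k ∧ (vecSplit k C hk v).2.toList = v.toList.drop k := ⟨rfl, rfl⟩

/-! ### The run of candidate 2 -/

section Run

variable (q m₃ : ℕ → ℕ) [∀ n, NeZero (q n)] (c cD c₃ : ℕ) (coins₃ : Polynomial ℕ) (n : ℕ)
  (κu : ℚ) (bu : ℕ) (PGu : PGParams) (L : ℕ) (θN : ℚ) (sN NN PN wN RN : ℕ) (Mx : ℕ) (dec : List Bool → List Bool → Bool)

/-- The test's tuple size `M = G·(N·m₃)`. [folklore] -/
abbrev c2M : ℕ := gridG q cD n * (gridBatches q cD c₃ n * m₃ n)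

/-- Region 1: the raising sampler's coins, `Mx·coinLen`. [folklore] -/
def c2W₁ : ℕ := Mx * PGu.coinLen
/-- Region 2: the fresh first coordinates, `M·L`. [folklore] -/
def c2W₂ : ℕ := c2M q m₃ cD c₃ n * L
/-- Region 3: the shift, `(d+1)·L`. [folklore] -/
def c2W₃ : ℕ := (dim n + 1) * L
/-- Region 4: hybrid `T₂`'s columns and noise, `n·(d+1)L + M·n·R(w+1+P)`. [folklore] -/
def c2W₄ : ℕ := n * ((dim n + 1) * L) + c2M q m₃ cD c₃ n * (n * (RN * (wN + 1 + PN)))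

/-- **Stage 4 (the test)**: the verdict from the transformed items and the test's coins. [cite: BrakerskiEtAl2013, Lemma 2.15] -/
def c2T4 (its : List LItem) (r : List Bool) : Bool :=
  tVerdictOf (tRecOf q m₃ c cD c₃ coins₃ n) (List.ofFn fun j : Fin (gridG q cD n * gridBatches q cD c₃ n + gridBatches q cD c₃ n) =>
    progBit q m₃ c cD c₃ coins₃ n dec its r j)

/-- **Stage 3**: hybrid `T₂` on region 4, then stage 4. [cite: BrakerskiEtAl2013, Lemma 4.9 (proof, ℬ₂)] -/
def c2T3 (its : List LItem) (r : List Bool) : Bool :=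
  c2T4 q m₃ c cD c₃ coins₃ n dec (hybT2Flat (modulus n) L n (dim n + 1) θN sN NN PN wN RN its (r.take (c2W₄ q m₃ cD c₃ n L PN wN RN)))
    (r.drop (c2W₄ q m₃ cD c₃ n L PN wN RN))

/-- **Stage 2**: the shift on region 3, then stage 3. [cite: BrakerskiEtAl2013, Def. 2.11 (remark)] -/
def c2T2 (its : List LItem) (r : List Bool) : Bool :=
  c2T3 q m₃ c cD c₃ coins₃ n L θN sN NN PN wN RN dec (shiftFlat (modulus n) L (dim n + 1) its (r.take (c2W₃ n L))) (r.drop (c2W₃ n L))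

/-- **Stage 1**: the dimension extension on region 2, then stage 2. [cite: BrakerskiEtAl2013, Thm. 4.1 (proof)] -/
def c2T1 (its : List LItem) (r : List Bool) : Bool :=
  c2T2 q m₃ c cD c₃ coins₃ n L θN sN NN PN wN RN dec (dimExtFlat (modulus n) L its (r.take (c2W₂ q m₃ cD c₃ n L))) (r.drop (c2W₂ q m₃ cD c₃ n L))

/-- **The verdict bit of candidate 2** on `(items, coins)`: raise on region 1, keep the first `M` items, then stage 1 on the rest (the subroutine's decisions
`dec` folded in). [cite: BrakerskiEtAl2013, Thm. 4.1 (proof), Lemma 2.15 and §5] -/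
def c2Bit (items : List LItem) (coins : List Bool) : Bool :=
  c2T1 q m₃ c cD c₃ coins₃ n L θN sN NN PN wN RN dec (padFlat (c2M q m₃ cD c₃ n) (raiseFlat (modulus n) κu bu PGu items (coins.take (c2W₁ PGu Mx))))
    (coins.drop (c2W₁ PGu Mx))

end Run

/-! ### The law on uniform coins, stage by stage -/

section Law

variable {q m₃ : ℕ → ℕ} [∀ n, NeZero (q n)] {c cD c₃ : ℕ} {coins₃ : Polynomial ℕ} {n : ℕ}
  (κu : ℚ) (bu : ℕ) (PGu : PGParams) (L : ℕ) (θN : ℚ) (sN NN PN wN RN : ℕ) {Mx : ℕ} (dec : List Bool → List Bool → Bool)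

/-- Stage 4 on uniform coins: `machTest`. [cite: BrakerskiEtAl2013, Lemma 2.15] -/
theorem uniformVector_map_c2T4 (hn : 0 < n) (S₃ : Fin (c2M q m₃ cD c₃ n) → (Fin n → ZMod (modulus n)) × ZMod (modulus n)) {C : ℕ}
    (hC : sliceW q m₃ c coins₃ n * (gridG q cD n * gridBatches q cD c₃ n + gridBatches q cD c₃ n) ≤ C) :
    (uniformOfFintype (List.Vector Bool C)).map (fun r => c2T4 q m₃ c cD c₃ coins₃ n dec (List.ofFn fun i => toItem (S₃ i)) r.toList) =
      machTest q m₃ c cD c₃ n (decKernel dec (lenOf coins₃)) S₃ :=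
  uniformVector_map_tVerdict hn S₃ hC

/-- Stage 3 on uniform coins: `machHybT2 ≫= machTest`. [cite: BrakerskiEtAl2013, Lemma 4.9 (proof, ℬ₂)] -/
theorem uniformVector_map_c2T3 (hn : 0 < n) (S₂ : Fin (c2M q m₃ cD c₃ n) → (Fin (dim n + 1) → ZMod (modulus n)) × ZMod (modulus n)) {C : ℕ}
    (hC : c2W₄ q m₃ cD c₃ n L PN wN RN + sliceW q m₃ c coins₃ n * (gridG q cD n * gridBatches q cD c₃ n + gridBatches q cD c₃ n) ≤ C) :
    (uniformOfFintype (List.Vector Bool C)).map (fun r => c2T3 q m₃ c cD c₃ coins₃ n L θN sN NN PN wN RN dec (List.ofFn fun i => toItem (S₂ i)) r.toList) =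
      (machHybT2 (n := n) L θN sN NN PN wN RN (c2M q m₃ cD c₃ n) S₂).bind (machTest q m₃ c cD c₃ n (decKernel dec (lenOf coins₃))) := by
  have hk : c2W₄ q m₃ cD c₃ n L PN wN RN ≤ C := by omega
  have e := uniformVector_map_split hk (fun r₄ : List.Vector Bool (c2W₄ q m₃ cD c₃ n L PN wN RN) =>
      hybT2Flat (modulus n) L n (dim n + 1) θN sN NN PN wN RN (List.ofFn fun i => toItem (S₂ i)) r₄.toList)
    (fun its₃ (r : List.Vector Bool (C - c2W₄ q m₃ cD c₃ n L PN wN RN)) => c2T4 q m₃ c cD c₃ coins₃ n dec its₃ r.toList)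
  refine Eq.trans ?_ (e.trans ?_)
  · rfl
  · rw [uniformVector_map_hybT2Flat (n := n) L θN sN NN PN wN RN S₂ (C := c2W₄ q m₃ cD c₃ n L PN wN RN) (le_of_eq rfl), PMF.bind_map]
    congr 1
    funext S₃
    exact uniformVector_map_c2T4 dec hn S₃ (by omega)

/-- Stage 2 on uniform coins: `machShift ≫= (machHybT2 ≫= machTest)`. [cite: BrakerskiEtAl2013, Def. 2.11 (remark)] -/
theorem uniformVector_map_c2T2 (hn : 0 < n) (S₁ : Fin (c2M q m₃ cD c₃ n) → (Fin (dim n + 1) → ZMod (modulus n)) × ZMod (modulus n)) {C : ℕ}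
    (hC : c2W₃ n L + c2W₄ q m₃ cD c₃ n L PN wN RN + sliceW q m₃ c coins₃ n * (gridG q cD n * gridBatches q cD c₃ n + gridBatches q cD c₃ n) ≤ C) :
    (uniformOfFintype (List.Vector Bool C)).map (fun r => c2T2 q m₃ c cD c₃ coins₃ n L θN sN NN PN wN RN dec (List.ofFn fun i => toItem (S₁ i)) r.toList) =
      (machShift L (c2M q m₃ cD c₃ n) S₁).bind fun S₂ =>
        (machHybT2 (n := n) L θN sN NN PN wN RN (c2M q m₃ cD c₃ n) S₂).bind (machTest q m₃ c cD c₃ n (decKernel dec (lenOf coins₃))) := by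
  have hk : c2W₃ n L ≤ C := by omega
  have e := uniformVector_map_split hk (fun r₃ : List.Vector Bool (c2W₃ n L) => shiftFlat (modulus n) L (dim n + 1) (List.ofFn fun i => toItem (S₁ i)) r₃.toList)
    (fun its₂ (r : List.Vector Bool (C - c2W₃ n L)) => c2T3 q m₃ c cD c₃ coins₃ n L θN sN NN PN wN RN dec its₂ r.toList)
  refine Eq.trans ?_ (e.trans ?_)
  · rfl
  · rw [uniformVector_map_shiftFlat L S₁ (C := c2W₃ n L) (le_of_eq rfl), PMF.bind_map]
    congr 1
    funext S₂
    exact uniformVector_map_c2T3 L θN sN NN PN wN RN dec hn S₂ (by omega)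

/-- Stage 1 on uniform coins: `machDimExt ≫= (machShift ≫= …)`. [cite: BrakerskiEtAl2013, Thm. 4.1 (proof)] -/
theorem uniformVector_map_c2T1 (hn : 0 < n) (S₀ : Fin (c2M q m₃ cD c₃ n) → (Fin (dim n) → ZMod (modulus n)) × ZMod (modulus n)) {C : ℕ}
    (hC : c2W₂ q m₃ cD c₃ n L + c2W₃ n L + c2W₄ q m₃ cD c₃ n L PN wN RN +
      sliceW q m₃ c coins₃ n * (gridG q cD n * gridBatches q cD c₃ n + gridBatches q cD c₃ n) ≤ C) :
    (uniformOfFintype (List.Vector Bool C)).map (fun r => c2T1 q m₃ c cD c₃ coins₃ n L θN sN NN PN wN RN dec (List.ofFn fun i => toItem (S₀ i)) r.toList) =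
      (machDimExt L (c2M q m₃ cD c₃ n) S₀).bind fun S₁ =>
        (machShift L (c2M q m₃ cD c₃ n) S₁).bind fun S₂ =>
          (machHybT2 (n := n) L θN sN NN PN wN RN (c2M q m₃ cD c₃ n) S₂).bind (machTest q m₃ c cD c₃ n (decKernel dec (lenOf coins₃))) := by
  have hk : c2W₂ q m₃ cD c₃ n L ≤ C := by omega
  have e := uniformVector_map_split hk (fun r₂ : List.Vector Bool (c2W₂ q m₃ cD c₃ n L) =>
      dimExtFlat (modulus n) L (List.ofFn fun i => toItem (S₀ i)) r₂.toList)
    (fun its₁ (r : List.Vector Bool (C - c2W₂ q m₃ cD c₃ n L)) => c2T2 q m₃ c cD c₃ coins₃ n L θN sN NN PN wN RN dec its₁ r.toList)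
  refine Eq.trans ?_ (e.trans ?_)
  · rfl
  · rw [uniformVector_map_dimExtFlat L S₀ (C := c2W₂ q m₃ cD c₃ n L) (le_of_eq rfl), PMF.bind_map]
    congr 1
    funext S₁
    exact uniformVector_map_c2T2 L θN sN NN PN wN RN dec hn S₁ (by omega)

/-- **The law of the candidate-2 verdict bit on uniform coins**: raise (region 1), pad, extend, shift, hybrid `T₂`, test.
[cite: BrakerskiEtAl2013, Thm. 4.1 (proof) and §5; AroraBarak2009, Def. 7.1] -/
theorem uniformVector_map_c2Bit (hn : 0 < n) (hM : c2M q m₃ cD c₃ n ≤ Mx) (S : Fin Mx → (Fin (dim n) → ZMod (modulus n)) × ZMod (modulus n)) {C : ℕ}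
    (hC : c2W₁ PGu Mx + c2W₂ q m₃ cD c₃ n L + c2W₃ n L + c2W₄ q m₃ cD c₃ n L PN wN RN +
      sliceW q m₃ c coins₃ n * (gridG q cD n * gridBatches q cD c₃ n + gridBatches q cD c₃ n) ≤ C) :
    (uniformOfFintype (List.Vector Bool C)).map (fun v => c2Bit q m₃ c cD c₃ coins₃ n κu bu PGu L θN sN NN PN wN RN Mx dec (List.ofFn fun i => toItem (S i)) v.toList) =
      (iidPMF (psiLaw (modulus n) (κu : ℝ) bu PGu.lawPMF) Mx).bind fun e =>
        (machDimExt L (c2M q m₃ cD c₃ n) (fun i : Fin (c2M q m₃ cD c₃ n) => addNoiseSample (S (Fin.castLE hM i)) (e (Fin.castLE hM i)))).bind fun S₁ =>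
          (machShift L (c2M q m₃ cD c₃ n) S₁).bind fun S₂ =>
            (machHybT2 (n := n) L θN sN NN PN wN RN (c2M q m₃ cD c₃ n) S₂).bind (machTest q m₃ c cD c₃ n (decKernel dec (lenOf coins₃))) := by
  have hk : c2W₁ PGu Mx ≤ C := by omega
  have e := uniformVector_map_split hk (fun r₁ : List.Vector Bool (c2W₁ PGu Mx) =>
      padFlat (c2M q m₃ cD c₃ n) (raiseFlat (modulus n) κu bu PGu (List.ofFn fun i => toItem (S i)) r₁.toList))
    (fun its₀ (r : List.Vector Bool (C - c2W₁ PGu Mx)) => c2T1 q m₃ c cD c₃ coins₃ n L θN sN NN PN wN RN dec its₀ r.toList)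
  -- the raise-and-pad stage's law
  have hraise : (uniformOfFintype (List.Vector Bool (c2W₁ PGu Mx))).map (fun r₁ : List.Vector Bool (c2W₁ PGu Mx) =>
      padFlat (c2M q m₃ cD c₃ n) (raiseFlat (modulus n) κu bu PGu (List.ofFn fun i => toItem (S i)) r₁.toList)) =
      (iidPMF (psiLaw (modulus n) (κu : ℝ) bu PGu.lawPMF) Mx).map fun e =>
        List.ofFn fun i : Fin (c2M q m₃ cD c₃ n) => toItem (addNoiseSample (S (Fin.castLE hM i)) (e (Fin.castLE hM i))) := by
    rw [show (fun r₁ : List.Vector Bool (c2W₁ PGu Mx) => padFlat (c2M q m₃ cD c₃ n) (raiseFlat (modulus n) κu bu PGu (List.ofFn fun i => toItem (S i)) r₁.toList)) =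
        padFlat (c2M q m₃ cD c₃ n) ∘ (fun r₁ : List.Vector Bool (c2W₁ PGu Mx) => raiseFlat (modulus n) κu bu PGu (List.ofFn fun i => toItem (S i)) r₁.toList) from rfl,
      ← PMF.map_comp, uniformVector_map_raiseFlat κu bu PGu S (C := c2W₁ PGu Mx) (le_of_eq (Nat.mul_comm PGu.coinLen Mx)), PMF.map_comp]
    congr 1
    funext e'
    exact padFlat_ofFn hM _
  refine Eq.trans ?_ (e.trans ?_)
  · rfl
  · rw [hraise, PMF.bind_map]
    congr 1
    funext e'
    exact uniformVector_map_c2T1 L θN sN NN PN wN RN dec hn _ (by omega)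

/-- **… which is `raiseThen (psiLaw) Mx (padThen h (machE₂ … (machTest … K))) S`.** [cite: BrakerskiEtAl2013, Thm. 4.1 (proof)] -/
theorem c2Law_eq (hM : c2M q m₃ cD c₃ n ≤ Mx) (S : Fin Mx → (Fin (dim n) → ZMod (modulus n)) × ZMod (modulus n))
    (K : (Fin (m₃ n) → (Fin n → ZMod (q n)) × ZMod (q n)) → PMF Bool) :
    raiseThen (psiLaw (modulus n) (κu : ℝ) bu PGu.lawPMF) Mx (padThen hM (machE₂ (n := n) L θN sN NN PN wN RN (c2M q m₃ cD c₃ n) (machTest q m₃ c cD c₃ n K))) S =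
      (iidPMF (psiLaw (modulus n) (κu : ℝ) bu PGu.lawPMF) Mx).bind fun e =>
        (machDimExt L (c2M q m₃ cD c₃ n) (fun i : Fin (c2M q m₃ cD c₃ n) => addNoiseSample (S (Fin.castLE hM i)) (e (Fin.castLE hM i)))).bind fun S₁ =>
          (machShift L (c2M q m₃ cD c₃ n) S₁).bind fun S₂ =>
            (machHybT2 (n := n) L θN sN NN PN wN RN (c2M q m₃ cD c₃ n) S₂).bind (machTest q m₃ c cD c₃ n K) := rfl

end Law

end KProg

end BLPRS2013

end Literature.Computability.Cryptography

end
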